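import Literature.Algebra.Homology.HyperExtComap
import Mathlib.Algebra.Homology.Additive
import HarnessLib

/-!
# Adjunctions on complexes and the adjunction map on hyper-Ext

* `mapHomologicalComplexAdj adj c` — an adjunction `L ⊣ R` of additive functors induces
  `L.mapHomologicalComplex c ⊣ R.mapHomologicalComplex c` (termwise; Mathlib only has the
  `Equivalence` version), with its unit / counit / hom-set bijection computed termwise;
* `HyperExt.adjunctionHom adj X K' n : HyperExt (L X) K' n →+ HyperExt X (R K') n` for `R` exact,
  `x ↦ η_X^*(R x)`, and its naturality in `K'` (`adjunctionHom_map`).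

## Why

For an open embedding `j : U ⊆ 𝒳`, `j_! ⊣ j^*` on abelian sheaves (`Topology/SheafOpenRestriction`:
`j^* = restrict`, exact, a left and a right adjoint): `adjunctionHom` is the map comparing
`HyperExt (j_! ℤ_U) K n` (cohomology "at `U`" on the site of `𝒳`, where Mathlib's Mayer–Vietoris
sequence lives) with `HyperExt ℤ_U (K|_U) n` (hypercohomology of the space `U`), the first brick of
"cohomology and localization" for `Crystalline/HodgeDeRhamGenericFibreReduction` (hypothesis H2).

## References

C. Weibel, *An introduction to homological algebra* (1994), §2.6 (adjoint functors and exactness),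
§10.7. [Weibel1994] Everything here is proved; no named facts.
-/

open CategoryTheory Limits

namespace Literature.Algebra.Homology

universe w w' v v' u u'

section Complexes

variable {ι : Type*} {V : Type u} [Category.{v} V] [Preadditive V] {W : Type u'} [Category.{v'} W]
  [Preadditive W] {L : V ⥤ W} {R : W ⥤ V} (adj : L ⊣ R) [L.Additive] [R.Additive]
  (c : ComplexShape ι)

/-- Termwise transpose `L K ⟶ K'` ↦ `K ⟶ R K'` (it commutes with the differentials by the
naturality of `adj.homEquiv`). [folklore] -/
noncomputable def mapHomologicalComplexAdj.homEquivToFun {K : HomologicalComplex V c}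
    {K' : HomologicalComplex W c} (f : (L.mapHomologicalComplex c).obj K ⟶ K') :
    K ⟶ (R.mapHomologicalComplex c).obj K' where
  f i := adj.homEquiv (K.X i) (K'.X i) (f.f i)
  comm' i j _ := by
    change adj.homEquiv (K.X i) (K'.X i) (f.f i) ≫ R.map (K'.d i j) =
      K.d i j ≫ adj.homEquiv (K.X j) (K'.X j) (f.f j)
    rw [← adj.homEquiv_naturality_right, ← adj.homEquiv_naturality_left]
    exact congrArg _ (f.comm i j)

/-- Termwise transpose `K ⟶ R K'` ↦ `L K ⟶ K'`. [folklore] -/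
noncomputable def mapHomologicalComplexAdj.homEquivInvFun {K : HomologicalComplex V c}
    {K' : HomologicalComplex W c} (g : K ⟶ (R.mapHomologicalComplex c).obj K') :
    (L.mapHomologicalComplex c).obj K ⟶ K' where
  f i := (adj.homEquiv (K.X i) (K'.X i)).symm (g.f i)
  comm' i j _ := by
    change (adj.homEquiv (K.X i) (K'.X i)).symm (g.f i) ≫ K'.d i j =
      L.map (K.d i j) ≫ (adj.homEquiv (K.X j) (K'.X j)).symm (g.f j)
    rw [← adj.homEquiv_naturality_right_symm, ← adj.homEquiv_naturality_left_symm]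
    exact congrArg _ (g.comm i j)

/-- **An adjunction `L ⊣ R` of additive functors induces an adjunction
`L.mapHomologicalComplex c ⊣ R.mapHomologicalComplex c`** on complexes (termwise hom-set
bijections; not in Mathlib, which has the `Equivalence` version
`Equivalence.mapHomologicalComplex`). (Weibel 2.6 / 10.7: adjoint additive functors act termwise on
complexes and stay adjoint.) [cite: Weibel1994, §2.6] -/
noncomputable def mapHomologicalComplexAdj :
    L.mapHomologicalComplex c ⊣ R.mapHomologicalComplex c :=
  Adjunction.mkOfHomEquiv
    { homEquiv := fun K K' =>
        { toFun := mapHomologicalComplexAdj.homEquivToFun adj c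
          invFun := mapHomologicalComplexAdj.homEquivInvFun adj c
          left_inv := fun f => by
            ext i
            exact (adj.homEquiv _ _).symm_apply_apply (f.f i)
          right_inv := fun g => by
            ext i
            exact (adj.homEquiv _ _).apply_symm_apply (g.f i) }
      homEquiv_naturality_left_symm := fun f g => by
        ext i
        exact adj.homEquiv_naturality_left_symm (f.f i) (g.f i)
      homEquiv_naturality_right := fun f g => by
        ext i
        exact adj.homEquiv_naturality_right (f.f i) (g.f i) }

/-- The unit of the induced adjunction is the unit termwise. [folklore] -/
theorem mapHomologicalComplexAdj_unit_app_f (K : HomologicalComplex V c) (i : ι) :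
    ((mapHomologicalComplexAdj adj c).unit.app K).f i = adj.unit.app (K.X i) := by
  change adj.homEquiv _ _ (𝟙 _) = _
  exact adj.homEquiv_id _

/-- The counit of the induced adjunction is the counit termwise. [folklore] -/
theorem mapHomologicalComplexAdj_counit_app_f (K' : HomologicalComplex W c) (i : ι) :
    ((mapHomologicalComplexAdj adj c).counit.app K').f i = adj.counit.app (K'.X i) := by
  change (adj.homEquiv _ _).symm (𝟙 _) = _
  exact adj.homEquiv_symm_id _

/-- The hom-set bijection of the induced adjunction is `adj.homEquiv` termwise. [folklore] -/
theorem mapHomologicalComplexAdj_homEquiv_apply_f {K : HomologicalComplex V c}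
    {K' : HomologicalComplex W c} (f : (L.mapHomologicalComplex c).obj K ⟶ K') (i : ι) :
    ((mapHomologicalComplexAdj adj c).homEquiv K K' f).f i = adj.homEquiv _ _ (f.f i) := by
  rw [Adjunction.homEquiv_unit, HomologicalComplex.comp_f, mapHomologicalComplexAdj_unit_app_f,
    Functor.mapHomologicalComplex_map_f]
  exact (adj.homEquiv_unit _ _ _).symm

end Complexes

section HyperExt

variable {C : Type u} [Category.{v} C] [Abelian C] {D : Type u'} [Category.{v'} D] [Abelian D]
  {L : C ⥤ D} {R : D ⥤ C} (adj : L ⊣ R) [R.Additive] [PreservesFiniteLimits R]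
  [PreservesFiniteColimits R]

namespace HyperExt

/-- **The adjunction map on hyper-Ext**: for `L ⊣ R` with `R` exact,
`HyperExt (L X) K' n → HyperExt X (R K') n`, `x ↦ η_X^* (R x)` — apply `R`
(`HyperExt.mapExactFunctor`, `HyperExtExactFunctor`), then pull back along the unit
`η_X : X → R L X` (`HyperExt.comap`, `HyperExtComap`). When `L` is exact as well this is the
derived adjunction bijection `Hom_{D(D)}(L X[0], K'⟦n⟧) ≃ Hom_{D(C)}(X[0], R K'⟦n⟧)`; the
bijectivity is NOT proved here (it needs the adjunction `D(L) ⊣ D(R)` of Mathlib's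
`Adjunction.localization` along `DerivedCategory.Q`). [folklore] -/
noncomputable def adjunctionHom (X : C) (K' : CochainComplex D ℤ) (n : ℤ)
    [HasHyperExt.{w'} (L.obj X) K']
    [HasHyperExt.{w} (R.obj (L.obj X)) ((R.mapHomologicalComplex (ComplexShape.up ℤ)).obj K')]
    [HasHyperExt.{w} X ((R.mapHomologicalComplex (ComplexShape.up ℤ)).obj K')] :
    HyperExt.{w'} (L.obj X) K' n →+
      HyperExt.{w} X ((R.mapHomologicalComplex (ComplexShape.up ℤ)).obj K') n :=
  (comap _ n (show X ⟶ R.obj (L.obj X) from adj.unit.app X)).comp (mapExactFunctor R n)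

/-- `adjunctionHom` unfolded. [folklore] -/
theorem adjunctionHom_apply (X : C) (K' : CochainComplex D ℤ) (n : ℤ)
    [HasHyperExt.{w'} (L.obj X) K']
    [HasHyperExt.{w} (R.obj (L.obj X)) ((R.mapHomologicalComplex (ComplexShape.up ℤ)).obj K')]
    [HasHyperExt.{w} X ((R.mapHomologicalComplex (ComplexShape.up ℤ)).obj K')]
    (x : HyperExt.{w'} (L.obj X) K' n) :
    adjunctionHom adj X K' n x =
      comap _ n (show X ⟶ R.obj (L.obj X) from adj.unit.app X) (mapExactFunctor R n x) :=
  rfl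

/-- Naturality of the adjunction map in the complex (`mapExactFunctor_map`, `map_comap`).
[folklore] -/
theorem adjunctionHom_map (X : C) {K' K'' : CochainComplex D ℤ} (f : K' ⟶ K'') (n : ℤ)
    [HasHyperExt.{w'} (L.obj X) K'] [HasHyperExt.{w'} (L.obj X) K'']
    [HasHyperExt.{w} (R.obj (L.obj X)) ((R.mapHomologicalComplex (ComplexShape.up ℤ)).obj K')]
    [HasHyperExt.{w} (R.obj (L.obj X)) ((R.mapHomologicalComplex (ComplexShape.up ℤ)).obj K'')]
    [HasHyperExt.{w} X ((R.mapHomologicalComplex (ComplexShape.up ℤ)).obj K')]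
    [HasHyperExt.{w} X ((R.mapHomologicalComplex (ComplexShape.up ℤ)).obj K'')]
    (x : HyperExt.{w'} (L.obj X) K' n) :
    adjunctionHom adj X K'' n (map f n x) =
      map ((R.mapHomologicalComplex (ComplexShape.up ℤ)).map f) n (adjunctionHom adj X K' n x) := by
  rw [adjunctionHom_apply, adjunctionHom_apply, mapExactFunctor_map, map_comap]

end HyperExt

end HyperExt

end Literature.Algebra.Homology
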